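import Literature.NumberTheory.DiophantineGeometry.TateAlgorithmTwoTorsionExitsProofs
import Literature.NumberTheory.DiophantineGeometry.ConductorFactorizationProofs
import Mathlib.AlgebraicGeometry.EllipticCurve.Affine.Basic
import HarnessLib

/-!
# A rational `2`-torsion point forces `f_v ≤ 2` at every place `v ∤ 2` (Ogg–Saito at `3`)

`Proofs` file (theorems only; no definition, no named fact, no instance) in topic
`NumberTheory/DiophantineGeometry`, companion of `Literature.NumberTheory.DiophantineGeometry.Conductor`;
second half (global / over `ℚ`) of the kernel proof whose DVR half is
`Literature.NumberTheory.DiophantineGeometry.TateAlgorithmTwoTorsionExitsProofs`.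

**Statement.** Let `E / K` be an elliptic curve over the fraction field of a Dedekind domain `A` and
`v` a finite place of `A` whose completed local ring `O_v` has perfect residue field and `2 ∈ O_vˣ`.
If the `2`-division cubic `ψ₂(x) = 4x³ + b₂x² + 2b₄x + b₆` has a root in `K_v` — in particular if
`E(K)` has a point of order `2` — then the Kodaira type of `E` at `v` is one of `I₀, Iₙ, III, I₀*, Iₙ*,
III*` (never `II, IV, IV*, II*`), and the conductor exponent satisfies `f_v ≤ 2` (no wild part).
Over `ℚ`: `ord_p N_E ≤ 2` for every odd prime `p`, in particular **`ord₃ N_E ≤ 2`** — the conductor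
of an elliptic curve over `ℚ` with a rational `2`-torsion point is cube-free away from `2`.

**Source.** J. H. Silverman, *Advanced Topics in the Arithmetic of Elliptic Curves* (ATAEC), GTM 151
(1994), §IV.10: the wild part `δ(E/K)` of the conductor is the Swan conductor of `E[ℓ]` for any prime
`ℓ ≠ p` (Serre–Tate; Thm IV.10.2 and the definition preceding it), so for `p ≠ 2` it can be read on
`E[2]`: a `K`-rational `2`-torsion point confines the image of inertia in `GL₂(𝔽₂) ≅ S₃` to a
subgroup of order `≤ 2`, on which the pro-`p` wild inertia acts trivially, whence `δ = 0` and
`f = ε ≤ 2` (Ogg 1967; Saito 1988). Néron-model form: for the types `II, IV, IV*, II*` the group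
`E(K_v)/E₀(K_v)` has order `1` or `3` (ATAEC IV.9.2, Table 4.1), `E₀/E₁ ≅ k⁺` is a `p`-group and
`E₁` has no prime-to-`p` torsion, so `E(K_v)[2] = 0`.

**Proof given here.** In this library `f_v` is *defined* by Ogg's formula
`f_v = ord_v(Δ_min) + 1 − m_v` (`WeierstrassCurve.conductorExponent`), with `m_v` read off from the
Kodaira symbol of the literal Tate algorithm `WeierstrassCurve.kodairaSymbolOfMinimal` (ATAEC IV.9.4) on
the integral local minimal model `M`. A root of `ψ₂` in `K_v` is transported to `M ⊗ K_v = C • (W ⊗ K_v)`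
(`x ↦ u⁻²(x − r)`, `twoTorsionRoot_smul`), is `O_v`-integral (`exists_twoTorsionRoot_of_baseChange`:
`4 ∈ O_vˣ` and `O_v` is a valuation ring), and then
`TateAlgorithm.kodairaSymbolOfMinimal_of_twoTorsionRoot` /
`TateAlgorithm.addVal_Δ_toNat_le_numComponents_add_one_of_twoTorsionRoot` give the type and
`ord_v(Δ_min) ≤ m_v + 1`; over `ℚ` at an odd prime `2 ∈ ℤ_pˣ`
(`Rat.isUnit_natCast_adicCompletionIntegers`) and `ord_p N_E = f_p` (`factorization_conductorNorm_holds`).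

## Main results

* `WeierstrassCurve.kodairaSymbolAt_of_twoTorsion`, `WeierstrassCurve.conductorExponent_le_two_of_twoTorsion`
  (root in `K_v`), `…_of_field` (root in `K`), `…_of_ringChar_ne_two`;
* `WeierstrassCurve.conductorExponent_le_two_of_natGenerator_ne_two_of_twoTorsion`,
  `WeierstrassCurve.factorization_conductorNorm_le_two_of_twoTorsion` — over `ℚ`, every odd prime;
* `WeierstrassCurve.factorization_conductorNorm_three_le_two_of_twoTorsionPoint` — `ord₃ N_E ≤ 2` from
  a rational affine point `(x, y)` with `2y + a₁x + a₃ = 0` (the shape `HasRationalTwoTorsionX` of the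
  BSD routes at `2`).

## References

* J. H. Silverman, *Advanced Topics in the Arithmetic of Elliptic Curves*, GTM 151, Springer 1994,
  IV.9.2, IV.9.4 and Table 4.1, §IV.10 (Thm 10.2), IV.11.1. [cite: Silverman1994, IV.10.2]
* J. H. Silverman, *The Arithmetic of Elliptic Curves*, GTM 106, 2nd ed. 2009, III.1 (Table 3.1),
  VII.1.3, VII.3. [cite: SilvermanAEC2009, III.1]
* A. P. Ogg, *Elliptic curves and wild ramification*, Amer. J. Math. 89 (1967) 1–21. [cite: Ogg1967]
* T. Saito, *Conductor, discriminant, and the Noether formula of arithmetic surfaces*, Duke Math. J.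
  57 (1988) 151–173.
-/

/-! ## At a finite place `v ∤ 2`: Kodaira type and conductor exponent with a `2`-torsion point -/

namespace WeierstrassCurve

open Literature.NumberTheory.DiophantineGeometry Literature.NumberTheory.DiophantineGeometry.TateAlgorithm
  IsDedekindDomain

section Transport

variable {F : Type*} [CommRing F] (W : WeierstrassCurve F) (C : VariableChange F)

/-- A root of the `2`-division cubic `ψ₂ = 4x³ + b₂x² + 2b₄x + b₆` is carried by any change of
variables: `ψ₂^{C • W}(u⁻²(x − r)) = u⁻⁶ ψ₂^{W}(x)` (Silverman AEC III.1, Table 3.1: `u²b₂' = b₂ + 12r`,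
`u⁴b₄' = b₄ + r b₂ + 6r²`, `u⁶b₆' = b₆ + 2r b₄ + r² b₂ + 4r³`). [cite: SilvermanAEC2009, III.1 Table 3.1] -/
theorem twoTorsionRoot_smul {x : F} (hx : 4 * x ^ 3 + W.b₂ * x ^ 2 + 2 * W.b₄ * x + W.b₆ = 0) :
    4 * ((C.u⁻¹ : Fˣ) ^ 2 * (x - C.r)) ^ 3 + (C • W).b₂ * ((C.u⁻¹ : Fˣ) ^ 2 * (x - C.r)) ^ 2 +
      2 * (C • W).b₄ * ((C.u⁻¹ : Fˣ) ^ 2 * (x - C.r)) + (C • W).b₆ = 0 := by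
  rw [variableChange_b₂, variableChange_b₄, variableChange_b₆]
  linear_combination ((C.u⁻¹ : Fˣ) : F) ^ 6 * hx

/-- A root of `ψ₂` is preserved by base change along a ring map (`bᵢ` are polynomial in the `aᵢ`,
Silverman AEC III.1). [cite: SilvermanAEC2009, III.1] -/
theorem twoTorsionRoot_map {S : Type*} [CommRing S] (φ : F →+* S) {x : F}
    (hx : 4 * x ^ 3 + W.b₂ * x ^ 2 + 2 * W.b₄ * x + W.b₆ = 0) :
    4 * φ x ^ 3 + (W.map φ).b₂ * φ x ^ 2 + 2 * (W.map φ).b₄ * φ x + (W.map φ).b₆ = 0 := by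
  rw [map_b₂, map_b₄, map_b₆]
  have := congrArg φ hx
  simpa only [map_add, map_mul, map_pow, map_ofNat, map_zero] using this

/-- A rational affine point `(x, y)` with `2y + a₁x + a₃ = 0` (a point of exact order `2`) has
`x`-coordinate a root of the `2`-division cubic: `ψ₂(x) = (2y + a₁x + a₃)² − 4·(Weierstrass equation)`.
Silverman AEC III.2.3 / Ex. 3.7. [cite: SilvermanAEC2009, III.2] -/
theorem twoTorsionRoot_of_equation {x y : F} (hE : W.toAffine.Equation x y)
    (h2 : 2 * y + W.a₁ * x + W.a₃ = 0) :
    4 * x ^ 3 + W.b₂ * x ^ 2 + 2 * W.b₄ * x + W.b₆ = 0 := by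
  rw [Affine.equation_iff] at hE
  simp only [b₂, b₄, b₆]
  linear_combination (-4 : F) * hE + (2 * y + W.a₁ * x + W.a₃) * h2

end Transport

section Local

variable {A : Type*} [CommRing A] [IsDedekindDomain A] {K : Type*} [Field K]
  [Algebra A K] [IsFractionRing A K] (v : HeightOneSpectrum A) (W : WeierstrassCurve K)

/-- A root in `K_v` of the `2`-division cubic of an `O_v`-integral equation `M` lies in `O_v` when
`2 ∈ O_vˣ`: `O_v` is a valuation ring, and if `z ∉ O_v` then `w = z⁻¹ ∈ O_v` with
`4 = −w(b₂ + 2b₄w + b₆w²)`, so `w ∣ 4` would be a unit and `z = w⁻¹ ∈ O_v` (roots of a polynomial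
with unit leading coefficient over a valuation ring are integral; cf. Silverman AEC VII.3.4, whose proof
uses exactly this for the coordinates of torsion points). [cite: SilvermanAEC2009, VII.3] -/
theorem exists_twoTorsionRoot_of_baseChange (M : WeierstrassCurve (v.adicCompletionIntegers K))
    (h2 : IsUnit (2 : v.adicCompletionIntegers K)) {z : v.adicCompletion K}
    (hz : 4 * z ^ 3 + (M.baseChange (v.adicCompletion K)).b₂ * z ^ 2 +
      2 * (M.baseChange (v.adicCompletion K)).b₄ * z + (M.baseChange (v.adicCompletion K)).b₆ = 0) :
    ∃ x : v.adicCompletionIntegers K, 4 * x ^ 3 + M.b₂ * x ^ 2 + 2 * M.b₄ * x + M.b₆ = 0 := by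
  simp only [baseChange, map_b₂, map_b₄, map_b₆] at hz
  by_cases hmem : z ∈ v.adicCompletionIntegers K
  · refine ⟨⟨z, hmem⟩, ?_⟩
    apply IsFractionRing.injective (v.adicCompletionIntegers K) (v.adicCompletion K)
    simp only [map_add, map_mul, map_pow, map_ofNat, map_zero]
    exact hz
  · exfalso
    have hinv : z⁻¹ ∈ v.adicCompletionIntegers K :=
      ((v.adicCompletionIntegers K).mem_or_inv_mem z).resolve_left hmem
    have hz0 : z ≠ 0 := by rintro rfl; exact hmem (v.adicCompletionIntegers K).zero_mem
    -- `w = z⁻¹ ∈ O_v`, written through `algebraMap O_v K_v`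
    obtain ⟨w, hw⟩ : ∃ w : v.adicCompletionIntegers K,
        algebraMap (v.adicCompletionIntegers K) (v.adicCompletion K) w = z⁻¹ := ⟨⟨z⁻¹, hinv⟩, rfl⟩
    have hwz : algebraMap (v.adicCompletionIntegers K) (v.adicCompletion K) w * z = 1 := by
      rw [hw]; exact inv_mul_cancel₀ hz0
    -- `4 + b₂ w + 2 b₄ w² + b₆ w³ = 0` in `O_v`
    have key : (4 : v.adicCompletionIntegers K) + M.b₂ * w + 2 * M.b₄ * w ^ 2 + M.b₆ * w ^ 3 = 0 := by
      apply IsFractionRing.injective (v.adicCompletionIntegers K) (v.adicCompletion K)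
      simp only [map_add, map_mul, map_pow, map_ofNat, map_zero]
      linear_combination (algebraMap (v.adicCompletionIntegers K) (v.adicCompletion K) w) ^ 3 * hz -
        (4 * (1 + z * algebraMap (v.adicCompletionIntegers K) (v.adicCompletion K) w +
              z ^ 2 * algebraMap (v.adicCompletionIntegers K) (v.adicCompletion K) w ^ 2) +
            algebraMap (v.adicCompletionIntegers K) (v.adicCompletion K) M.b₂ *
                algebraMap (v.adicCompletionIntegers K) (v.adicCompletion K) w *
              (1 + z * algebraMap (v.adicCompletionIntegers K) (v.adicCompletion K) w) +
          2 * algebraMap (v.adicCompletionIntegers K) (v.adicCompletion K) M.b₄ *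
            algebraMap (v.adicCompletionIntegers K) (v.adicCompletion K) w ^ 2) * hwz
    have hwu : IsUnit w := isUnit_of_dvd_unit
      ⟨-(M.b₂ + 2 * M.b₄ * w + M.b₆ * w ^ 2), by linear_combination key⟩ (isUnit_four h2)
    obtain ⟨w', hw'⟩ := hwu.exists_left_inv
    apply hmem
    have hz' : algebraMap (v.adicCompletionIntegers K) (v.adicCompletion K) w' = z := by
      have e := congrArg (algebraMap (v.adicCompletionIntegers K) (v.adicCompletion K)) hw'
      rw [map_mul, map_one] at e
      calc algebraMap (v.adicCompletionIntegers K) (v.adicCompletion K) w'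
          = algebraMap (v.adicCompletionIntegers K) (v.adicCompletion K) w' *
              (algebraMap (v.adicCompletionIntegers K) (v.adicCompletion K) w * z) := by
            rw [hwz, mul_one]
        _ = z := by rw [← mul_assoc, e, one_mul]
    rw [← hz']
    exact w'.2

/-- The integral local minimal model is `K_v`-isomorphic to `W`: `M ⊗ K_v = C • (W ⊗ K_v)` for the
change of variables chosen by Mathlib's `WeierstrassCurve.minimal` (Silverman AEC VII.1, Prop. 1.3(a):
a minimal equation exists and is reached by a change of variables over `K_v`). [cite: SilvermanAEC2009, VII.1.3] -/
theorem exists_localMinimalIntegralModel_baseChange_eq :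
    ∃ C : VariableChange (v.adicCompletion K),
      (W.localMinimalIntegralModel v).baseChange (v.adicCompletion K) =
        C • W.baseChange (v.adicCompletion K) :=
  ⟨_, by rw [localMinimalIntegralModel, baseChange_integralModel_eq]; rfl⟩

/-- **Kodaira type at `v ∤ 2` in the presence of a `K_v`-rational `2`-torsion point.** If `2 ∈ O_vˣ`,
the residue field of `O_v` is perfect and the `2`-division cubic of `W` has a root in `K_v`, then the
Kodaira symbol of an elliptic `W` at `v` is `I_{ord_v Δ_min}`, `III`, `III*` or `Iₙ*` (never
`II, IV, IV*, II*`): the root is transported to the integral local minimal model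
(`exists_localMinimalIntegralModel_baseChange_eq`, `twoTorsionRoot_smul`,
`exists_twoTorsionRoot_of_baseChange`) and `TateAlgorithm.kodairaSymbolOfMinimal_of_twoTorsionRoot`
applies (Step 11 excluded by `localMinimalIntegralModel_step11`). Silverman ATAEC IV.9.2 / Table 4.1
(component groups) with IV.10.2. [cite: Silverman1994, IV.9.4 and Table 4.1] -/
theorem kodairaSymbolAt_of_twoTorsion [W.IsElliptic]
    [PerfectField (IsLocalRing.ResidueField (v.adicCompletionIntegers K))]
    (h2 : IsUnit (2 : v.adicCompletionIntegers K)) {z : v.adicCompletion K}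
    (hz : 4 * z ^ 3 + (W.baseChange (v.adicCompletion K)).b₂ * z ^ 2 +
      2 * (W.baseChange (v.adicCompletion K)).b₄ * z + (W.baseChange (v.adicCompletion K)).b₆ = 0) :
    W.kodairaSymbolAt v = .I (W.ordMinimalDiscriminant v) ∨ W.kodairaSymbolAt v = .III ∨
      W.kodairaSymbolAt v = .IIIstar ∨ ∃ n, W.kodairaSymbolAt v = .Istar n := by
  obtain ⟨C, hC⟩ := W.exists_localMinimalIntegralModel_baseChange_eq v
  have hz' := twoTorsionRoot_smul (W.baseChange (v.adicCompletion K)) C hz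
  rw [← hC] at hz'
  obtain ⟨x, hx⟩ := exists_twoTorsionRoot_of_baseChange v (W.localMinimalIntegralModel v) h2 hz'
  rw [kodairaSymbolAt_def]
  unfold ordMinimalDiscriminant
  exact kodairaSymbolOfMinimal_of_twoTorsionRoot h2 (W.localMinimalIntegralModel v)
    (fun C hu h1 h2 h3 h4 h6 ↦ localMinimalIntegralModel_step11 v W C hu h1 h2 h3 h4 h6) hx

/-- **`f_v ≤ 2` at `v ∤ 2` in the presence of a `K_v`-rational `2`-torsion point** (local form; `f_v`
defined by Ogg's formula): `ord_v(Δ_min) ≤ m_v + 1` by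
`TateAlgorithm.addVal_Δ_toNat_le_numComponents_add_one_of_twoTorsionRoot` on the integral local minimal
model. This is Silverman ATAEC IV.10.2(b) combined with "the wild part `δ` is the Swan conductor of
`E[2]`, trivial when inertia fixes a `2`-torsion point and `p ≠ 2`" (§IV.10). [cite: Silverman1994, IV.10.2] -/
theorem conductorExponent_le_two_of_twoTorsion [W.IsElliptic]
    [PerfectField (IsLocalRing.ResidueField (v.adicCompletionIntegers K))]
    (h2 : IsUnit (2 : v.adicCompletionIntegers K)) {z : v.adicCompletion K}
    (hz : 4 * z ^ 3 + (W.baseChange (v.adicCompletion K)).b₂ * z ^ 2 +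
      2 * (W.baseChange (v.adicCompletion K)).b₄ * z + (W.baseChange (v.adicCompletion K)).b₆ = 0) :
    W.conductorExponent v ≤ 2 := by
  obtain ⟨C, hC⟩ := W.exists_localMinimalIntegralModel_baseChange_eq v
  have hz' := twoTorsionRoot_smul (W.baseChange (v.adicCompletion K)) C hz
  rw [← hC] at hz'
  obtain ⟨x, hx⟩ := exists_twoTorsionRoot_of_baseChange v (W.localMinimalIntegralModel v) h2 hz'
  unfold conductorExponent ordMinimalDiscriminant numComponentsAt
  rw [kodairaSymbolAt_def]
  have := addVal_Δ_toNat_le_numComponents_add_one_of_twoTorsionRoot h2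
    (W.localMinimalIntegralModel v) (localMinimalIntegralModel_Δ_ne_zero v W)
    (fun C hu h1 h2 h3 h4 h6 ↦ localMinimalIntegralModel_step11 v W C hu h1 h2 h3 h4 h6) hx
  omega

/-- `f_v ≤ 2` at `v ∤ 2` when the `2`-division cubic has a root in `K` (e.g. `E(K)` has a point of
order `2`). [cite: Silverman1994, IV.10.2] -/
theorem conductorExponent_le_two_of_twoTorsion_of_field [W.IsElliptic]
    [PerfectField (IsLocalRing.ResidueField (v.adicCompletionIntegers K))]
    (h2 : IsUnit (2 : v.adicCompletionIntegers K)) {x : K}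
    (hx : 4 * x ^ 3 + W.b₂ * x ^ 2 + 2 * W.b₄ * x + W.b₆ = 0) :
    W.conductorExponent v ≤ 2 :=
  W.conductorExponent_le_two_of_twoTorsion v h2
    (twoTorsionRoot_map W (algebraMap K (v.adicCompletion K)) hx)

/-- The Kodaira type at `v ∤ 2` when the `2`-division cubic has a root in `K`. [cite: Silverman1994, IV.9.4 and Table 4.1] -/
theorem kodairaSymbolAt_of_twoTorsion_of_field [W.IsElliptic]
    [PerfectField (IsLocalRing.ResidueField (v.adicCompletionIntegers K))]
    (h2 : IsUnit (2 : v.adicCompletionIntegers K)) {x : K}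
    (hx : 4 * x ^ 3 + W.b₂ * x ^ 2 + 2 * W.b₄ * x + W.b₆ = 0) :
    W.kodairaSymbolAt v = .I (W.ordMinimalDiscriminant v) ∨ W.kodairaSymbolAt v = .III ∨
      W.kodairaSymbolAt v = .IIIstar ∨ ∃ n, W.kodairaSymbolAt v = .Istar n :=
  W.kodairaSymbolAt_of_twoTorsion v h2 (twoTorsionRoot_map W (algebraMap K (v.adicCompletion K)) hx)

/-- `f_v ≤ 2` at a place of residue characteristic `≠ 2` (hypothesis on `A ⧸ v`) when the `2`-division
cubic has a root in `K`. [cite: Silverman1994, IV.10.2] -/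
theorem conductorExponent_le_two_of_twoTorsion_of_ringChar_ne_two [W.IsElliptic]
    [PerfectField (IsLocalRing.ResidueField (v.adicCompletionIntegers K))]
    (h2 : ringChar (A ⧸ v.asIdeal) ≠ 2) {x : K}
    (hx : 4 * x ^ 3 + W.b₂ * x ^ 2 + 2 * W.b₄ * x + W.b₆ = 0) :
    W.conductorExponent v ≤ 2 :=
  W.conductorExponent_le_two_of_twoTorsion_of_field v
    (HeightOneSpectrum.isUnit_two_adicCompletionIntegers K v h2) hx

end Local

/-! ## Over `ℚ`: `ord_p N_E ≤ 2` at every odd prime for a curve with a rational `2`-torsion point -/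

section Rat

variable (W : WeierstrassCurve ℚ) [W.IsElliptic]

/-- Over `ℚ`, at a place `v` over an odd prime: `f_v ≤ 2` if `E(ℚ)` has a point of order `2` (a
rational root of `ψ₂`). `2 ∈ ℤ_pˣ` by `Rat.isUnit_natCast_adicCompletionIntegers`, the residue field
`𝔽_p` is finite hence perfect. [cite: Silverman1994, IV.10.2] -/
theorem conductorExponent_le_two_of_natGenerator_ne_two_of_twoTorsion (v : HeightOneSpectrum ℤ)
    (hp : Rat.HeightOneSpectrum.natGenerator v ≠ 2) {x : ℚ}
    (hx : 4 * x ^ 3 + W.b₂ * x ^ 2 + 2 * W.b₄ * x + W.b₆ = 0) :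
    W.conductorExponent v ≤ 2 := by
  have h2 : IsUnit (2 : v.adicCompletionIntegers ℚ) := by
    have h := Rat.isUnit_natCast_adicCompletionIntegers v (n := 2) (fun h ↦ hp
      ((Nat.prime_dvd_prime_iff_eq (Rat.HeightOneSpectrum.prime_natGenerator v) Nat.prime_two).mp h))
    simpa using h
  exact W.conductorExponent_le_two_of_twoTorsion_of_field v h2 hx

/-- Over `ℚ`: **`ord_p N_E ≤ 2` for every odd prime `p`** if `E(ℚ)` has a point of order `2`
(`factorization_conductorNorm_holds`: the exponent of `p` in `N_E` is `f_p`). [cite: Silverman1994, IV.10.2] -/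
theorem factorization_conductorNorm_le_two_of_twoTorsion {p : ℕ} (hp : p.Prime) (hp2 : p ≠ 2)
    {x : ℚ} (hx : 4 * x ^ 3 + W.b₂ * x ^ 2 + 2 * W.b₄ * x + W.b₆ = 0) :
    (W.conductorNorm ℤ).factorization p ≤ 2 := by
  set v : HeightOneSpectrum ℤ := (Rat.HeightOneSpectrum.primesEquiv (R := ℤ)).symm ⟨p, hp⟩ with hv
  have hgen : Rat.HeightOneSpectrum.natGenerator v = p :=
    congrArg Subtype.val ((Rat.HeightOneSpectrum.primesEquiv (R := ℤ)).apply_symm_apply ⟨p, hp⟩)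
  rw [← hgen, W.factorization_conductorNorm_holds v]
  exact W.conductorExponent_le_two_of_natGenerator_ne_two_of_twoTorsion v (hgen ▸ hp2) hx

/-- Over `ℚ`: **`ord₃ N_E ≤ 2`** for an elliptic curve with a rational affine point `(x, y)` satisfying
`2y + a₁x + a₃ = 0` (a rational point of order `2`) — Ogg–Saito at `3`: the wild conductor at `3` is
read on `E[2]`, on which wild inertia then acts trivially. This is the printed input «`ord₃ N ≤ 2`» of
the BSD routes at `2` (cube-freeness of the conductor of a curve with rational `2`-torsion).
[cite: Silverman1994, IV.10.2] -/
theorem factorization_conductorNorm_three_le_two_of_twoTorsionPoint {x y : ℚ}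
    (hE : W.toAffine.Equation x y) (h2 : 2 * y + W.a₁ * x + W.a₃ = 0) :
    (W.conductorNorm ℤ).factorization 3 ≤ 2 :=
  W.factorization_conductorNorm_le_two_of_twoTorsion Nat.prime_three (by decide)
    (W.twoTorsionRoot_of_equation hE h2)

end Rat

end WeierstrassCurve
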